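import Mathlib
import Summits.ValiantsHypothesis.ValiantsHypothesis.Theorems.BarrierLeverPartitionMinorsHitByVPHiddenStatesTwoSkeleton

/-!
# Route BarrierLever — item `PartitionMinorsHitByVP` (stmt-ValiantsHypothesis-19717):
# the 2-skeleton obstruction on its whole two-layer WINDOW (general count form)

Helper file (`--supports stmt-ValiantsHypothesis-19717`; cell valiant-natproofs, rung V4, 𝒟-side door (c), line
`hidden-states`; prover seat val-np-p3 gen 9). Definition-free. Closes NO item.

`…HiddenStatesTwoSkeleton.not_ballGood_triples` refutes the single cube at `K = h²` (`h = 8m`). The same argument works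
for every state count `K` in the two-layer regime of the family of triples as long as the explicit count holds; this file
states it with the arithmetic as hypotheses, so that any `(h, K)` of the census window (memo HOME/val-np-p3/g9 §10:
`K ∈ [K₂(C(h,3)), ≈ C(h,3) − 1 − c*(h)]`, e.g. h = 9: [16,38], h = 10: [19,59], h = 12: [?,147]) can be instantiated by
`decide`/`norm_num` on numerals.

* `not_ballGood_triples_of_count` — `K' ≤ K`, `C(h,3) ≤ 1 + K + C(K',2)`, `(K+1) + K'·h < C(h,3)` ⇒
  `¬ BallGood h K C(h,3) (tripleU h)`.

WHAT THIS IS NOT: the sharpened bound with `− C(h,2)` (which matches the census thresholds exactly) is not formalised; the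
three-layer start of the window is not covered; nothing on the door of record `K = h³`, joins, crux 14610 or VP ≠ VNP.
-/

set_option linter.dupNamespace false

namespace Summit.ValiantsHypothesis.ValiantsHypothesis.Theorems.BarrierLever.HiddenStates

open Finset Matrix

noncomputable section

namespace TripleRank

/-- **The 2-skeleton obstruction, general two-layer form.** For any `h, K` and any `K' ≤ K` with
`C(h,3) ≤ 1 + K + C(K',2)` (so the ball–colex family of size `C(h,3)` is two-layer with its pairs inside the first
`K'` states) and `(K+1) + K'·h < C(h,3)`, the family of all triples of `Fin h` is NOT `BallGood h K C(h,3)`.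
(The instance `K = h²`, `K' = h²/8`, `h = 8m` is `not_ballGood_triples`; the census lineage can instantiate any
`(h, K)` in the window `K₂(C(h,3)) ≤ K`, `(K+1) + K'(c)·h < C(h,3)` with `c = C(h,3) − 1 − K`.) -/
theorem not_ballGood_triples_of_count (h K K' : ℕ) (hK' : K' ≤ K)
    (hr2 : ((Finset.univ : Finset (Fin h)).powersetCard 3).card ≤ 1 + K + K'.choose 2)
    (hcount : (K + 1) + K' * h < ((Finset.univ : Finset (Fin h)).powersetCard 3).card) :
    ¬ BallGood h K (((Finset.univ : Finset (Fin h)).powersetCard 3).card) (tripleU h) := by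
  classical
  set r := ((Finset.univ : Finset (Fin h)).powersetCard 3).card with hr
  have hrc : r = h.choose 3 := card_powersetCard_three h
  have hr1 : r ≤ 1 + K + K.choose 2 := hr2.trans (by
    have := Nat.choose_le_choose 2 hK'
    omega)
  intro hgood
  have hrK : r ≤ 2 ^ K := by
    -- r ≤ 1 + K + C(K,2) ≤ 2^K (the sets of size ≤ 2 of `Fin K` inject into all subsets)
    have h2 : 1 + K + K.choose 2 ≤ 2 ^ K := by
      have hsum : ∑ i ∈ Finset.range 3, K.choose i ≤ ∑ i ∈ Finset.range (K + 1), K.choose i := by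
        rcases Nat.lt_or_ge K 2 with hK2 | hK2
        · interval_cases K <;> simp [Finset.sum_range_succ]
        · exact Finset.sum_le_sum_of_subset (Finset.range_subset_range.mpr (by omega))
      rw [Nat.sum_range_choose] at hsum
      simpa [Finset.sum_range_succ, Nat.choose_zero_right, Nat.choose_one_right, add_assoc] using hsum
    exact hr1.trans h2
  obtain ⟨e, he, hthr⟩ := exists_ballColex K r hrK
  obtain ⟨tx, htx⟩ := hgood e he hthr
  apply htx
  have he2 : ∀ k, (e k).card ≤ 2 := fun k => card_le_two_of_threshold hr1 e hthr k
  have heS : ∀ k, (e k).card = 2 → e k ⊆ lowStates K K' hK' := fun k hk =>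
    pair_subset_lowStates_of_threshold hK' hr2 e hthr k hk
  refine det_eq_zero_of_many_small_rows (tripleU h) e (lowStates K K' hK') he2 heS ?_ tx
  rw [card_lowStates]
  have hall : Fintype.card {i : Fin r // (tripleU h i).card ≤ 3} = r := by
    rw [Fintype.card_subtype, Finset.filter_true_of_mem (fun i _ => (card_tripleU h i).le), Finset.card_univ,
      Fintype.card_fin]
  rw [hall]
  exact hcount

/-- **The single cube fails on the whole range `h² ≤ K ≤ h³/32`** (`h = 8m`, `m ≥ 6`): for every such state count the
family of all triples of `Fin h` is not `BallGood h K C(h,3)`. (Instance of `not_ballGood_triples_of_count` with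
`K' = h²/8 = 8m²`: `C(8m²,2) ≥ C(8m,3)` and `6·(K + 1 + 64m³) ≤ 6·(16m³ + 1 + 64m³) < 8m(8m−1)(8m−2) = 6·C(8m,3)`.)
So a single-cube hidden-state design needs more than `h³/32` states (the sharpened census bound says `≈ h³/6`); the
door of record `partitionMinorsHitByVP_of_ballGood_cube` allows up to `h³`. -/
theorem not_ballGood_triples_range (m K : ℕ) (hm : 6 ≤ m) (hKlo : (8 * m) * (8 * m) ≤ K)
    (hKhi : K ≤ 16 * m ^ 3) :
    ¬ BallGood (8 * m) K (((Finset.univ : Finset (Fin (8 * m))).powersetCard 3).card) (tripleU (8 * m)) := by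
  set h := 8 * m with hh
  have hrc : ((Finset.univ : Finset (Fin h)).powersetCard 3).card = h.choose 3 := card_powersetCard_three h
  have h6r : 6 * h.choose 3 = h * (h - 1) * (h - 2) := by
    obtain ⟨N, hN⟩ : ∃ N, h = N + 2 := ⟨h - 2, by omega⟩
    rw [hN, six_mul_choose_three N]
    simp
  have h2K' : 2 * (8 * m * m).choose 2 = (8 * m * m) * (8 * m * m - 1) := by
    have hpos : 1 ≤ 8 * m * m := by nlinarith
    obtain ⟨N, hN⟩ : ∃ N, 8 * m * m = N + 1 := ⟨8 * m * m - 1, by omega⟩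
    rw [hN, two_mul_choose_two N]; simp
  have hK' : 8 * m * m ≤ K := le_trans (by rw [hh] at hKlo; nlinarith) hKlo
  refine not_ballGood_triples_of_count h K (8 * m * m) hK' ?_ ?_
  · -- C(h,3) ≤ 1 + K + C(8m²,2)
    rw [hrc]
    have : 6 * h.choose 3 ≤ 6 * (8 * m * m).choose 2 := by
      rw [h6r]
      have e1 : h * (h - 1) * (h - 2) ≤ h * h * h := by gcongr <;> omega
      have h7 : 7 * m * m ≤ 8 * m * m - 1 := by
        have : 7 * m * m + 1 ≤ 8 * m * m := by nlinarith
        omega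
      have e4 : (8 * m * m) * (7 * m * m) ≤ (8 * m * m) * (8 * m * m - 1) := Nat.mul_le_mul_left _ h7
      have e3 : h * h * h ≤ 3 * ((8 * m * m) * (8 * m * m - 1)) := by
        rw [hh]
        nlinarith [e4, hm]
      nlinarith [h2K', e1, e3]
    omega
  · -- (K+1) + 8m²·h < C(h,3):  32·6·(K + 1 + 64m³) ≤ 10(8m)³ + 192 < 32·8m(8m−1)(8m−2)
    rw [hrc]
    obtain ⟨N, hN⟩ : ∃ N, h = N + 2 := ⟨h - 2, by omega⟩
    have h6 : 6 * h.choose 3 = (N + 2) * (N + 1) * N := by rw [hN, six_mul_choose_three N]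
    have hN46 : 46 ≤ N := by omega
    have hK32 : 32 * K ≤ (N + 2) * (N + 2) * (N + 2) := by
      have : (N + 2) * (N + 2) * (N + 2) = 512 * m ^ 3 := by rw [← hN, hh]; ring
      rw [this]; omega
    have hcube : 32 * (8 * m * m * h) = 4 * ((N + 2) * (N + 2) * (N + 2)) := by
      rw [hh] at hN ⊢
      have : 8 * m = N + 2 := hN
      calc 32 * (8 * m * m * (8 * m)) = 4 * ((8 * m) * (8 * m) * (8 * m)) := by ring
        _ = 4 * ((N + 2) * (N + 2) * (N + 2)) := by rw [this]
    have key : 32 * (6 * ((K + 1) + 8 * m * m * h)) < 32 * (6 * h.choose 3) := by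
      rw [h6]
      nlinarith [hK32, hcube, hN46]
    omega

/-- **Corollary (no single cube with `K ≤ h³/32` states).** For every `h₁` and every state budget `Kf` with
`h·h ≤ Kf h ≤ h³/32` from `h₁` on, the hypothesis «every injective family is `BallGood h (Kf h) r`» fails. -/
theorem not_ballGood_cube_below (Kf : ℕ → ℕ)
    (hK : ∃ h₁ : ℕ, ∀ h : ℕ, h₁ ≤ h → h * h ≤ Kf h ∧ 32 * Kf h ≤ h * h * h) :
    ¬ ∃ h₁ : ℕ, ∀ h : ℕ, h₁ ≤ h → ∀ (r : ℕ) (u : Fin r → Finset (Fin h)), Function.Injective u →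
      BallGood h (Kf h) r u := by
  rintro ⟨h₁, H⟩
  obtain ⟨h₀, hK⟩ := hK
  set m := max 6 (max h₀ h₁) with hmdef
  have hm : 6 ≤ m := le_max_left _ _
  have hle₁ : h₁ ≤ 8 * m := le_trans (le_trans (le_max_right h₀ h₁) (le_max_right 6 _)) (by omega)
  have hle₀ : h₀ ≤ 8 * m := le_trans (le_trans (le_max_left h₀ h₁) (le_max_right 6 _)) (by omega)
  obtain ⟨hlo, hhi⟩ := hK (8 * m) hle₀
  have hhi' : Kf (8 * m) ≤ 16 * m ^ 3 := by
    have : (8 * m) * (8 * m) * (8 * m) = 32 * (16 * m ^ 3) := by ring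
    rw [this] at hhi
    omega
  exact not_ballGood_triples_range m (Kf (8 * m)) hm hlo hhi'
    (H (8 * m) hle₁ _ (tripleU (8 * m)) (tripleU_injective _))

end TripleRank

end

end Summit.ValiantsHypothesis.ValiantsHypothesis.Theorems.BarrierLever.HiddenStates
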